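import Summits.Langlands.Langlands.Theses.SphericalRigiditySplit

/-!
# Route SphericalRigiditySplit — Assembly

The assembly item (stmt-Langlands-28321) of the child route `SphericalRigiditySplit` (decomp-langlands lens-2 gen 23; V-R refining child
`--refines route-Langlands-IwahoriBlockSplit:IwahoriBlockMatching`, 89th cell route) for IW = `IwahoriBlockSplit.IwahoriBlockMatching` (stmt-Langlands-28113):
`UnramifiedCompatibleAvatar → MonodromicTwistMatching → RecRigidity → Summit.Langlands.Langlands.Theses.IwahoriBlockSplit.IwahoriBlockMatching`.

This is literally the type of the route file's sorry-free deciding theorem `Summit.Langlands.Langlands.Theses.SphericalRigiditySplit.closes`.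
Nothing here proves `Langlands` (nor the parent piece): the assembly records only that the items of the route, taken together, imply the parent piece
by name.
-/

set_option linter.dupNamespace false -- project-wide option (lakefile weak.linter.dupNamespace); `Summit.Langlands.Langlands` is the mandated namespace

namespace Summit.Langlands.Langlands.Theorems

/-- **Assembly of route SphericalRigiditySplit** (stmt-Langlands-28321):
`UnramifiedCompatibleAvatar → MonodromicTwistMatching → RecRigidity → Summit.Langlands.Langlands.Theses.IwahoriBlockSplit.IwahoriBlockMatching`.
Proof: unfold `Assembly` and apply the route's deciding theorem `Theses.SphericalRigiditySplit.closes`. -/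
theorem sphericalRigiditySplit_assembly_proof :
    Summit.Langlands.Langlands.Theses.SphericalRigiditySplit.Assembly := by
  unfold Summit.Langlands.Langlands.Theses.SphericalRigiditySplit.Assembly
  exact Summit.Langlands.Langlands.Theses.SphericalRigiditySplit.closes

end Summit.Langlands.Langlands.Theorems
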